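import Mathlib.MeasureTheory.Function.L2Space
import Mathlib.MeasureTheory.Function.LpSeminorm.CompareExp
import Literature.MathematicalPhysics.KineticTheory.InfiniteChainOrbitEnergyFlux
import Literature.MathematicalPhysics.KineticTheory.InfiniteChainObservables
import HarnessLib

/-!
# Moments of the bond current under Buttà–Marchioro's superstability estimate

Topic `Literature/MathematicalPhysics/KineticTheory` (companion of `InfiniteChainSuperstableDynamics`,
`InfiniteChainSuperstableEstimates`, `InfiniteChainOrbitEnergyFlux`). For the infinite chain
`P : OscillatorChain` with non-negative measurable pinning `U` and an even non-negative polynomial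
coupling `V` of degree `2s₂ ≥ 2` (Buttà–Marchioro, J. Stat. Phys. 164 (2016), §2), and a state `μ`
obeying BM's superstability estimate (2.3) (`HasSuperstabilityEstimate`: `μ(e^{λ W_{m,k}}) ≤ e^{C(2k+1)}`
uniformly in the box centre `m`), the elementary moment bounds needed by the single TERMS of the
Green–Kubo objects `currentCorrelation` / `HasAbsConvergentCorrelation` of `InfiniteChainDynamics`:
* §1 pointwise: the bond current `bondCurrentZ` (`j_x = -½(p_x + p_{x+1}) V'(q_{x+1} - q_x)`,
  measurable by `measurable_bondCurrentZ` of `InfiniteChainObservables`) obeys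
  `|j_x(σ)| ≤ K · W_{x,1}(σ)²` (`|p_i| ≤ W`; `|V'(r)| ≤ 2C₁C₂ W` on a bond of the box by the
  derivative bound and the coercivity of an even polynomial);
* §2 under (2.3): `e^{λ₀ W_{m,k}} ∈ L¹(μ)`, all powers `W_{m,k}^n ∈ L¹(μ)`, hence `W_{m,k}, j_x ∈ L^p(μ)`
  for every `p < ∞`, and `∫ j_x² dμ ≤ B` UNIFORMLY in the bond `x` (from the uniformity of (2.3) in
  the box centre; no translation invariance of `μ` is used);
* §3 along a `μ`-preserving map `φ` (e.g. `φ = D.flow t` under `D.PreservesMeasure μ`): every product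
  `j_y · (j_x ∘ φ)` is `μ`-integrable and `|∫ j_y (j_x ∘ φ) dμ| ≤ B` uniformly in `x, y, φ` — the
  integrability clause of `HasAbsConvergentCorrelation μ t` at every `t` and a uniform bound on the
  terms of `currentCorrelation μ t`; the SUMMABILITY clause (decay in `x`: spatial mixing of `μ` plus
  locality of the flow) is not touched here;
* §4 the instances for the tree's `pinnedChain ω₂ lam β γ` (`ω₂, lam ≥ 0`, `β > 0`).

Everything is proved; standard estimates, tagged `[folklore]`. No definitions, no named facts.
-/

noncomputable section

open MeasureTheory Filter Set
open scoped Topology BigOperators ENNReal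

namespace Literature.MathematicalPhysics.KineticTheory.HeatConduction

namespace OscillatorChain

variable {P : OscillatorChain}

/-! ### §1 Pointwise bounds for the bond current -/

/-- `w ^ n ≤ (n! / λ^n) e^{λ w}` for `w ≥ 0`, `λ > 0` (from `x^n / n! ≤ eˣ`). [folklore] -/
theorem pow_le_factorial_div_pow_mul_exp {lam w : ℝ} (hlam : 0 < lam) (hw : 0 ≤ w) (n : ℕ) :
    w ^ n ≤ (n.factorial : ℝ) / lam ^ n * Real.exp (lam * w) := by
  have h := Real.pow_div_factorial_le_exp (lam * w) (mul_nonneg hlam.le hw) n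
  have hf : (0 : ℝ) < n.factorial := by exact_mod_cast Nat.factorial_pos n
  rw [div_le_iff₀ hf, mul_pow] at h
  rw [div_mul_eq_mul_div, le_div_iff₀ (pow_pos hlam n)]
  nlinarith

/-- **Pointwise bound of the bond current by the local energy.** For `U ≥ 0` and `V` an even
non-negative polynomial of degree `2s₂ ≥ 2` there is `K ≥ 0` with `|j_x(σ)| ≤ K · W_{x,1}(σ)²` for
all configurations `σ` and bonds `x` (`|p_x|, |p_{x+1}| ≤ W_{x,1}`; `|V'(r)| ≤ C₁(1+|r|)^{2s₂-1} ≤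
C₁C₂(V(r)+1) ≤ 2C₁C₂ W_{x,1}` for the bond `r = q_{x+1} - q_x` of the box `Λ_{x,1}`). [folklore] -/
theorem exists_abs_bondCurrentZ_le {s₂ : ℕ} (h₂ : 1 ≤ s₂) (hU0 : ∀ r, 0 ≤ P.U r)
    (hV : IsEvenPolyOfDegree P.V s₂) :
    ∃ K : ℝ, 0 ≤ K ∧ ∀ (σ : ChainConfig) (x : ℤ),
      |P.bondCurrentZ σ x| ≤ K * P.bmLocalEnergy x 1 σ ^ 2 := by
  obtain ⟨C₁, hC₁, hV', -⟩ := hV.exists_deriv_bound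
  obtain ⟨C₂, hC₂, hcoer⟩ := hV.exists_one_add_abs_pow_le h₂
  have hV0 : ∀ r, 0 ≤ P.V r := hV.choose_spec.2.2
  refine ⟨2 * C₁ * C₂, by positivity, fun σ x => ?_⟩
  set W := P.bmLocalEnergy x 1 σ with hW
  have hW1 : 1 ≤ W := one_le_bmLocalEnergy hU0 hV0 x 1 σ
  have hmem : ∀ i : ℤ, x ≤ i → i ≤ x + 1 → i ∈ Finset.Icc (x - ((1 : ℕ) : ℤ)) (x + ((1 : ℕ) : ℤ)) :=
    fun i h1 h2 => by simp only [Finset.mem_Icc, Nat.cast_one]; omega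
  have hp0 : |(σ x).2| ≤ W := abs_snd_le_bmLocalEnergy hU0 hV0 σ (hmem x le_rfl (by omega))
  have hp1 : |(σ (x + 1)).2| ≤ W := abs_snd_le_bmLocalEnergy hU0 hV0 σ (hmem (x + 1) (by omega) le_rfl)
  set r : ℝ := (σ (x + 1)).1 - (σ x).1 with hr
  have hVr : P.V r ≤ W := by
    have h := bond_le_bmLocalEnergy hU0 hV0 σ (hmem (x + 1) (by omega) le_rfl)
      (hmem (x + 1 - 1) (by omega) (by omega))
    simpa only [add_sub_cancel_right] using h
  have hdV : |deriv P.V r| ≤ 2 * C₁ * C₂ * W := by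
    have h1 : (1 + |r|) ^ (2 * s₂ - 1) ≤ (1 + |r|) ^ (2 * s₂) :=
      pow_le_pow_right₀ (by linarith [abs_nonneg r]) (Nat.sub_le _ _)
    calc |deriv P.V r| ≤ C₁ * (1 + |r|) ^ (2 * s₂ - 1) := hV' r
      _ ≤ C₁ * (1 + |r|) ^ (2 * s₂) := mul_le_mul_of_nonneg_left h1 hC₁
      _ ≤ C₁ * (C₂ * (P.V r + 1)) := mul_le_mul_of_nonneg_left (hcoer r) hC₁
      _ ≤ C₁ * (C₂ * (2 * W)) := by gcongr; linarith
      _ = 2 * C₁ * C₂ * W := by ring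
  have hsum : |((σ x).2 + (σ (x + 1)).2) / 2| ≤ W := by
    rw [abs_div, abs_two]
    linarith [abs_add_le (σ x).2 (σ (x + 1)).2]
  calc |P.bondCurrentZ σ x| = |((σ x).2 + (σ (x + 1)).2) / 2| * |deriv P.V r| := by
        rw [bondCurrentZ, abs_neg, abs_mul]
    _ ≤ W * (2 * C₁ * C₂ * W) :=
        mul_le_mul hsum hdV (abs_nonneg _) (zero_le_one.trans hW1)
    _ = 2 * C₁ * C₂ * W ^ 2 := by ring

/-! ### §2 Moments under the superstability estimate (2.3) -/

/-- A real function all of whose absolute powers are integrable w.r.t. a finite measure lies in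
`L^p` for every `p < ∞`. [folklore] -/
theorem memLp_of_integrable_abs_pow {α : Type*} [MeasurableSpace α] {μ : Measure α}
    [IsFiniteMeasure μ] {f : α → ℝ} (hf : AEStronglyMeasurable f μ)
    (hint : ∀ n : ℕ, Integrable (fun a => |f a| ^ n) μ) {p : ℝ≥0∞} (hp : p ≠ ∞) :
    MemLp f p μ := by
  by_cases hp0 : p = 0
  · rw [hp0, memLp_zero_iff_aestronglyMeasurable]
    exact hf
  set n : ℕ := ⌈p.toReal⌉₊ with hn
  have hpos : 0 < p.toReal := ENNReal.toReal_pos hp0 hp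
  have hn0 : n ≠ 0 := Nat.pos_iff_ne_zero.1 (Nat.ceil_pos.2 hpos)
  have hn0' : (n : ℝ≥0∞) ≠ 0 := by exact_mod_cast hn0
  have hmem : MemLp f (n : ℝ≥0∞) μ := by
    rw [← integrable_norm_rpow_iff hf hn0' (ENNReal.natCast_ne_top n)]
    refine (hint n).congr (Eventually.of_forall fun a => ?_)
    show |f a| ^ n = ‖f a‖ ^ (n : ℝ≥0∞).toReal
    rw [ENNReal.toReal_natCast, Real.rpow_natCast, Real.norm_eq_abs]
  refine hmem.mono_exponent ?_
  calc p = ENNReal.ofReal p.toReal := (ENNReal.ofReal_toReal hp).symm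
    _ ≤ ENNReal.ofReal (n : ℝ) := ENNReal.ofReal_le_ofReal (Nat.le_ceil _)
    _ = (n : ℝ≥0∞) := ENNReal.ofReal_natCast n

/-- **Exponential moments of the local energies under (2.3).** If `μ` satisfies BM's superstability
estimate and `U`, `V` are measurable, then for the constants `C, λ₀` of (2.3),
`e^{λ₀ W_{m,k}} ∈ L¹(μ)` and `∫ e^{λ₀ W_{m,k}} dμ ≤ e^{C(2k+1)}` for all `m ∈ ℤ`, `k ∈ ℕ`. [cite: ButtaMarchioro2016, §2 eq. (2.3)] -/
theorem HasSuperstabilityEstimate.exists_integrable_exp_mul_bmLocalEnergy {μ : Measure ChainConfig}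
    (hss : P.HasSuperstabilityEstimate μ) (hUm : Measurable P.U) (hVm : Measurable P.V) :
    ∃ C lam₀ : ℝ, 0 < C ∧ 0 < lam₀ ∧ ∀ (m : ℤ) (k : ℕ),
      Integrable (fun σ => Real.exp (lam₀ * P.bmLocalEnergy m k σ)) μ ∧
      ∫ σ, Real.exp (lam₀ * P.bmLocalEnergy m k σ) ∂μ ≤ Real.exp (C * (2 * (k : ℝ) + 1)) := by
  obtain ⟨-, C, lam₀, hC, hlam₀, hbound⟩ := hss
  refine ⟨C, lam₀, hC, hlam₀, fun m k => ?_⟩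
  have hb := hbound lam₀ hlam₀ le_rfl m k
  have hmeas : Measurable fun σ => Real.exp (lam₀ * P.bmLocalEnergy m k σ) :=
    Real.measurable_exp.comp ((P.measurable_bmLocalEnergy hUm hVm m k).const_mul lam₀)
  have hnn : 0 ≤ᵐ[μ] fun σ => Real.exp (lam₀ * P.bmLocalEnergy m k σ) :=
    Eventually.of_forall fun σ => (Real.exp_pos _).le
  have hint : Integrable (fun σ => Real.exp (lam₀ * P.bmLocalEnergy m k σ)) μ := by
    refine ⟨hmeas.aestronglyMeasurable, ?_⟩
    rw [hasFiniteIntegral_iff_ofReal hnn]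
    exact lt_of_le_of_lt hb ENNReal.ofReal_lt_top
  refine ⟨hint, ?_⟩
  rw [integral_eq_lintegral_of_nonneg_ae hnn hmeas.aestronglyMeasurable]
  calc (∫⁻ σ, ENNReal.ofReal (Real.exp (lam₀ * P.bmLocalEnergy m k σ)) ∂μ).toReal
      ≤ (ENNReal.ofReal (Real.exp (C * (2 * (k : ℝ) + 1)))).toReal :=
        ENNReal.toReal_mono ENNReal.ofReal_ne_top hb
    _ = Real.exp (C * (2 * (k : ℝ) + 1)) := ENNReal.toReal_ofReal (Real.exp_pos _).le

/-- **All powers of the local energies are integrable under (2.3)** (`U, V ≥ 0` measurable):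
`W_{m,k}^n ∈ L¹(μ)` with `∫ W_{m,k}^n dμ ≤ (n!/λ₀^n) e^{C(2k+1)}`. [folklore] -/
theorem HasSuperstabilityEstimate.exists_integral_bmLocalEnergy_pow_le {μ : Measure ChainConfig}
    (hss : P.HasSuperstabilityEstimate μ) (hU0 : ∀ r, 0 ≤ P.U r) (hV0 : ∀ r, 0 ≤ P.V r)
    (hUm : Measurable P.U) (hVm : Measurable P.V) :
    ∃ C lam₀ : ℝ, 0 < C ∧ 0 < lam₀ ∧ ∀ (m : ℤ) (k n : ℕ),
      Integrable (fun σ => P.bmLocalEnergy m k σ ^ n) μ ∧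
      ∫ σ, P.bmLocalEnergy m k σ ^ n ∂μ ≤
        (n.factorial : ℝ) / lam₀ ^ n * Real.exp (C * (2 * (k : ℝ) + 1)) := by
  obtain ⟨C, lam₀, hC, hlam₀, hexp⟩ := hss.exists_integrable_exp_mul_bmLocalEnergy hUm hVm
  refine ⟨C, lam₀, hC, hlam₀, fun m k n => ?_⟩
  obtain ⟨hint, hle⟩ := hexp m k
  have hW0 : ∀ σ, 0 ≤ P.bmLocalEnergy m k σ := fun σ =>
    zero_le_one.trans (one_le_bmLocalEnergy hU0 hV0 m k σ)
  have hpt : ∀ σ, P.bmLocalEnergy m k σ ^ n ≤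
      (n.factorial : ℝ) / lam₀ ^ n * Real.exp (lam₀ * P.bmLocalEnergy m k σ) := fun σ =>
    pow_le_factorial_div_pow_mul_exp hlam₀ (hW0 σ) n
  have hdom : Integrable (fun σ => (n.factorial : ℝ) / lam₀ ^ n *
      Real.exp (lam₀ * P.bmLocalEnergy m k σ)) μ := hint.const_mul _
  have hintn : Integrable (fun σ => P.bmLocalEnergy m k σ ^ n) μ := by
    refine hdom.mono' ((P.measurable_bmLocalEnergy hUm hVm m k).pow_const n).aestronglyMeasurable
      (Eventually.of_forall fun σ => ?_)
    rw [Real.norm_of_nonneg (pow_nonneg (hW0 σ) n)]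
    exact hpt σ
  refine ⟨hintn, ?_⟩
  calc ∫ σ, P.bmLocalEnergy m k σ ^ n ∂μ
      ≤ ∫ σ, (n.factorial : ℝ) / lam₀ ^ n * Real.exp (lam₀ * P.bmLocalEnergy m k σ) ∂μ :=
        integral_mono hintn hdom hpt
    _ = (n.factorial : ℝ) / lam₀ ^ n * ∫ σ, Real.exp (lam₀ * P.bmLocalEnergy m k σ) ∂μ :=
        integral_const_mul _ _
    _ ≤ (n.factorial : ℝ) / lam₀ ^ n * Real.exp (C * (2 * (k : ℝ) + 1)) :=
        mul_le_mul_of_nonneg_left hle (by positivity)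

/-- The local energies lie in `L^p(μ)` for every `p < ∞` under (2.3). [folklore] -/
theorem HasSuperstabilityEstimate.memLp_bmLocalEnergy {μ : Measure ChainConfig}
    (hss : P.HasSuperstabilityEstimate μ) (hU0 : ∀ r, 0 ≤ P.U r) (hV0 : ∀ r, 0 ≤ P.V r)
    (hUm : Measurable P.U) (hVm : Measurable P.V) (m : ℤ) (k : ℕ) {p : ℝ≥0∞} (hp : p ≠ ∞) :
    MemLp (P.bmLocalEnergy m k) p μ := by
  haveI : IsProbabilityMeasure μ := hss.1
  obtain ⟨C, lam₀, -, -, h⟩ := hss.exists_integral_bmLocalEnergy_pow_le hU0 hV0 hUm hVm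
  refine memLp_of_integrable_abs_pow
    (P.measurable_bmLocalEnergy hUm hVm m k).aestronglyMeasurable (fun n => ?_) hp
  refine ((h m k n).1).congr (Eventually.of_forall fun σ => ?_)
  show P.bmLocalEnergy m k σ ^ n = |P.bmLocalEnergy m k σ| ^ n
  rw [abs_of_nonneg (zero_le_one.trans (one_le_bmLocalEnergy hU0 hV0 m k σ))]

/-- **All moments of the bond current are finite under (2.3)**: `∫ |j_x|^n dμ ≤ Kⁿ (2n)!/λ₀^{2n} e^{3C}`,
uniformly in the bond `x`. [folklore] -/
theorem HasSuperstabilityEstimate.exists_integral_abs_bondCurrentZ_pow_le {μ : Measure ChainConfig}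
    (hss : P.HasSuperstabilityEstimate μ) {s₂ : ℕ} (h₂ : 1 ≤ s₂) (hU0 : ∀ r, 0 ≤ P.U r)
    (hUm : Measurable P.U) (hV : IsEvenPolyOfDegree P.V s₂) :
    ∃ M : ℕ → ℝ, ∀ (n : ℕ) (x : ℤ), Integrable (fun σ => |P.bondCurrentZ σ x| ^ n) μ ∧
      ∫ σ, |P.bondCurrentZ σ x| ^ n ∂μ ≤ M n := by
  have hV0 : ∀ r, 0 ≤ P.V r := hV.choose_spec.2.2
  have hVm : Measurable P.V := hV.continuous.measurable
  obtain ⟨K, hK, hj⟩ := exists_abs_bondCurrentZ_le h₂ hU0 hV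
  obtain ⟨C, lam₀, hC, hlam₀, hW⟩ := hss.exists_integral_bmLocalEnergy_pow_le hU0 hV0 hUm hVm
  refine ⟨fun n => K ^ n * (((2 * n).factorial : ℝ) / lam₀ ^ (2 * n) *
    Real.exp (C * (2 * ((1 : ℕ) : ℝ) + 1))), fun n x => ?_⟩
  obtain ⟨hintW, hleW⟩ := hW x 1 (2 * n)
  have hpt : ∀ σ, |P.bondCurrentZ σ x| ^ n ≤ K ^ n * P.bmLocalEnergy x 1 σ ^ (2 * n) := by
    intro σ
    calc |P.bondCurrentZ σ x| ^ n ≤ (K * P.bmLocalEnergy x 1 σ ^ 2) ^ n :=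
          pow_le_pow_left₀ (abs_nonneg _) (hj σ x) n
      _ = K ^ n * P.bmLocalEnergy x 1 σ ^ (2 * n) := by rw [mul_pow, ← pow_mul]
  have hdom : Integrable (fun σ => K ^ n * P.bmLocalEnergy x 1 σ ^ (2 * n)) μ := hintW.const_mul _
  have hint : Integrable (fun σ => |P.bondCurrentZ σ x| ^ n) μ := by
    refine hdom.mono'
      ((continuous_abs.measurable.comp (measurable_bondCurrentZ P x)).pow_const n).aestronglyMeasurable
      (Eventually.of_forall fun σ => ?_)
    rw [Real.norm_of_nonneg (pow_nonneg (abs_nonneg _) n)]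
    exact hpt σ
  refine ⟨hint, ?_⟩
  calc ∫ σ, |P.bondCurrentZ σ x| ^ n ∂μ ≤ ∫ σ, K ^ n * P.bmLocalEnergy x 1 σ ^ (2 * n) ∂μ :=
        integral_mono hint hdom hpt
    _ = K ^ n * ∫ σ, P.bmLocalEnergy x 1 σ ^ (2 * n) ∂μ := integral_const_mul _ _
    _ ≤ K ^ n * (((2 * n).factorial : ℝ) / lam₀ ^ (2 * n) *
          Real.exp (C * (2 * ((1 : ℕ) : ℝ) + 1))) :=
        mul_le_mul_of_nonneg_left hleW (pow_nonneg hK n)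

/-- **The bond current lies in `L^p(μ)` for every `p < ∞`** under the superstability estimate (2.3)
(`U ≥ 0` measurable, `V` an even non-negative polynomial of degree `≥ 2`). [folklore] -/
theorem HasSuperstabilityEstimate.memLp_bondCurrentZ {μ : Measure ChainConfig}
    (hss : P.HasSuperstabilityEstimate μ) {s₂ : ℕ} (h₂ : 1 ≤ s₂) (hU0 : ∀ r, 0 ≤ P.U r)
    (hUm : Measurable P.U) (hV : IsEvenPolyOfDegree P.V s₂) (x : ℤ) {p : ℝ≥0∞} (hp : p ≠ ∞) :
    MemLp (fun σ => P.bondCurrentZ σ x) p μ := by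
  haveI : IsProbabilityMeasure μ := hss.1
  obtain ⟨M, hM⟩ := hss.exists_integral_abs_bondCurrentZ_pow_le h₂ hU0 hUm hV
  exact memLp_of_integrable_abs_pow (measurable_bondCurrentZ P x).aestronglyMeasurable
    (fun n => (hM n x).1) hp

/-- **Uniform second moments of the bond current**: under (2.3) there is `B ≥ 0` with
`j_x² ∈ L¹(μ)` and `∫ j_x² dμ ≤ B` for every bond `x`. [folklore] -/
theorem HasSuperstabilityEstimate.exists_integral_bondCurrentZ_sq_le {μ : Measure ChainConfig}
    (hss : P.HasSuperstabilityEstimate μ) {s₂ : ℕ} (h₂ : 1 ≤ s₂) (hU0 : ∀ r, 0 ≤ P.U r)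
    (hUm : Measurable P.U) (hV : IsEvenPolyOfDegree P.V s₂) :
    ∃ B : ℝ, 0 ≤ B ∧ ∀ x : ℤ, Integrable (fun σ => P.bondCurrentZ σ x ^ 2) μ ∧
      ∫ σ, P.bondCurrentZ σ x ^ 2 ∂μ ≤ B := by
  obtain ⟨M, hM⟩ := hss.exists_integral_abs_bondCurrentZ_pow_le h₂ hU0 hUm hV
  refine ⟨max (M 2) 0, le_max_right _ _, fun x => ?_⟩
  obtain ⟨hint, hle⟩ := hM 2 x
  have e : (fun σ => P.bondCurrentZ σ x ^ 2) = fun σ => |P.bondCurrentZ σ x| ^ 2 :=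
    funext fun σ => (sq_abs _).symm
  rw [e]
  exact ⟨hint, hle.trans (le_max_left _ _)⟩

/-! ### §3 Products along a measure-preserving map: the terms of the current autocorrelation -/

/-- **Integrability of the correlation integrands.** If `μ` satisfies (2.3) and `φ` preserves `μ`
(e.g. `φ = D.flow t` for a dynamics `D` with `D.PreservesMeasure μ`), then `j_y · (j_x ∘ φ) ∈ L¹(μ)`
for all bonds `x, y` (both factors are in `L²(μ)`, the second by invariance). [folklore] -/
theorem HasSuperstabilityEstimate.integrable_bondCurrentZ_mul_comp {μ : Measure ChainConfig}
    (hss : P.HasSuperstabilityEstimate μ) {s₂ : ℕ} (h₂ : 1 ≤ s₂) (hU0 : ∀ r, 0 ≤ P.U r)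
    (hUm : Measurable P.U) (hV : IsEvenPolyOfDegree P.V s₂) {φ : ChainConfig → ChainConfig}
    (hφ : MeasurePreserving φ μ μ) (x y : ℤ) :
    Integrable (fun σ => P.bondCurrentZ σ y * P.bondCurrentZ (φ σ) x) μ := by
  have h2 : (2 : ℝ≥0∞) ≠ ∞ := ENNReal.ofNat_ne_top
  have hy := hss.memLp_bondCurrentZ h₂ hU0 hUm hV y h2
  have hx := (hss.memLp_bondCurrentZ h₂ hU0 hUm hV x h2).comp_measurePreserving hφ
  exact hy.integrable_mul hx

/-- **Uniform bound on the correlation terms**: under (2.3), `|∫ j_y (j_x ∘ φ) dμ| ≤ B` for every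
`μ`-preserving `φ` and all bonds (`|ab| ≤ (a²+b²)/2`, invariance, uniform second moments). [folklore] -/
theorem HasSuperstabilityEstimate.exists_abs_integral_bondCurrentZ_mul_comp_le
    {μ : Measure ChainConfig} (hss : P.HasSuperstabilityEstimate μ) {s₂ : ℕ} (h₂ : 1 ≤ s₂)
    (hU0 : ∀ r, 0 ≤ P.U r) (hUm : Measurable P.U) (hV : IsEvenPolyOfDegree P.V s₂) :
    ∃ B : ℝ, 0 ≤ B ∧ ∀ (φ : ChainConfig → ChainConfig), MeasurePreserving φ μ μ →
      ∀ x y : ℤ, |∫ σ, P.bondCurrentZ σ y * P.bondCurrentZ (φ σ) x ∂μ| ≤ B := by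
  obtain ⟨B, hB, hsq⟩ := hss.exists_integral_bondCurrentZ_sq_le h₂ hU0 hUm hV
  refine ⟨B, hB, fun φ hφ x y => ?_⟩
  obtain ⟨hiy, hley⟩ := hsq y
  obtain ⟨hix, hlex⟩ := hsq x
  have hprod := hss.integrable_bondCurrentZ_mul_comp h₂ hU0 hUm hV hφ x y
  -- the square of the translated factor is integrable with the same integral
  have hixφ : Integrable (fun σ => P.bondCurrentZ (φ σ) x ^ 2) μ :=
    hφ.integrable_comp_of_integrable hix
  have heq : ∫ σ, P.bondCurrentZ (φ σ) x ^ 2 ∂μ = ∫ σ, P.bondCurrentZ σ x ^ 2 ∂μ := by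
    have h := integral_map (μ := μ) hφ.measurable.aemeasurable
      (f := fun σ => P.bondCurrentZ σ x ^ 2)
      (by rw [hφ.map_eq]; exact ((measurable_bondCurrentZ P x).pow_const 2).aestronglyMeasurable)
    rw [hφ.map_eq] at h
    exact h.symm
  have hdom : Integrable (fun σ => (P.bondCurrentZ σ y ^ 2 + P.bondCurrentZ (φ σ) x ^ 2) / 2) μ :=
    (hiy.add hixφ).div_const 2
  calc |∫ σ, P.bondCurrentZ σ y * P.bondCurrentZ (φ σ) x ∂μ|
      ≤ ∫ σ, |P.bondCurrentZ σ y * P.bondCurrentZ (φ σ) x| ∂μ := abs_integral_le_integral_abs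
    _ ≤ ∫ σ, (P.bondCurrentZ σ y ^ 2 + P.bondCurrentZ (φ σ) x ^ 2) / 2 ∂μ := by
        refine integral_mono hprod.abs hdom fun σ => ?_
        have h := two_mul_le_add_sq |P.bondCurrentZ σ y| |P.bondCurrentZ (φ σ) x|
        rw [sq_abs, sq_abs] at h
        simp only [abs_mul]
        linarith
    _ = ((∫ σ, P.bondCurrentZ σ y ^ 2 ∂μ) + ∫ σ, P.bondCurrentZ (φ σ) x ^ 2 ∂μ) / 2 := by
        rw [integral_div, integral_add hiy hixφ]
    _ ≤ (B + B) / 2 := by rw [heq]; gcongr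
    _ = B := by ring

end OscillatorChain

namespace InfiniteChainDynamics

variable {P : OscillatorChain} (D : InfiniteChainDynamics P)

/-- **The integrability clause of `HasAbsConvergentCorrelation` at every time**: under (2.3) and
`D.PreservesMeasure μ`, every correlation integrand `σ ↦ j_y(σ) j_x(φ_t σ)` is `μ`-integrable
(`U ≥ 0` measurable, `V` an even non-negative polynomial of degree `≥ 2`); summability in `x` is NOT
asserted. [folklore] -/
theorem integrable_bondCurrentZ_mul_bondCurrentZ_flow {μ : Measure ChainConfig}
    (hss : P.HasSuperstabilityEstimate μ) {s₂ : ℕ} (h₂ : 1 ≤ s₂) (hU0 : ∀ r, 0 ≤ P.U r)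
    (hUm : Measurable P.U) (hV : OscillatorChain.IsEvenPolyOfDegree P.V s₂)
    (hD : D.PreservesMeasure μ) (t : ℝ) (x y : ℤ) :
    Integrable (fun σ => P.bondCurrentZ σ y * P.bondCurrentZ (D.flow t σ) x) μ :=
  hss.integrable_bondCurrentZ_mul_comp h₂ hU0 hUm hV (hD.2 t) x y

/-- **Uniform bound on the terms of the current autocorrelation**: under (2.3) and
`D.PreservesMeasure μ` there is `B ≥ 0` with `|∫ j_y (j_x ∘ φ_t) dμ| ≤ B` for all `t, x, y`. [folklore] -/
theorem exists_abs_integral_bondCurrentZ_mul_bondCurrentZ_flow_le {μ : Measure ChainConfig}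
    (hss : P.HasSuperstabilityEstimate μ) {s₂ : ℕ} (h₂ : 1 ≤ s₂) (hU0 : ∀ r, 0 ≤ P.U r)
    (hUm : Measurable P.U) (hV : OscillatorChain.IsEvenPolyOfDegree P.V s₂)
    (hD : D.PreservesMeasure μ) :
    ∃ B : ℝ, 0 ≤ B ∧ ∀ (t : ℝ) (x y : ℤ),
      |∫ σ, P.bondCurrentZ σ y * P.bondCurrentZ (D.flow t σ) x ∂μ| ≤ B := by
  obtain ⟨B, hB, h⟩ := hss.exists_abs_integral_bondCurrentZ_mul_comp_le h₂ hU0 hUm hV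
  exact ⟨B, hB, fun t x y => h (D.flow t) (hD.2 t) x y⟩

end InfiniteChainDynamics

/-! ### §4 The pinned anharmonic chain `pinnedChain ω₂ lam β γ` -/

namespace OscillatorChain

/-- The pinning of `pinnedChain` is non-negative for `ω₂, lam ≥ 0`. [folklore] -/
theorem pinnedChain_U_nonneg {ω₂ lam : ℝ} (β γ : ℝ) (hω : 0 ≤ ω₂) (hl : 0 ≤ lam) (q : ℝ) :
    0 ≤ (pinnedChain ω₂ lam β γ).U q := by
  show 0 ≤ ω₂ * q ^ 2 / 2 + lam * q ^ 4 / 4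
  positivity

/-- The pinning of `pinnedChain` is measurable. [folklore] -/
theorem measurable_pinnedChain_U (ω₂ lam β γ : ℝ) : Measurable (pinnedChain ω₂ lam β γ).U := by
  show Measurable fun q : ℝ => ω₂ * q ^ 2 / 2 + lam * q ^ 4 / 4
  fun_prop

/-- **Transport integrability for the pinned anharmonic chain** (`ω₂, lam ≥ 0`, `β > 0`): for a state
`μ` with BM's superstability estimate and a dynamics `D` preserving `μ`, every `j_0 · (j_x ∘ φ_t)` is
`μ`-integrable — the first clause of `D.HasAbsConvergentCorrelation μ t`, at every `t`. [folklore] -/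
theorem hasAbsConvergentCorrelation_integrable_pinnedChain {ω₂ lam β : ℝ} (γ : ℝ) (hω : 0 ≤ ω₂)
    (hl : 0 ≤ lam) (hβ : 0 < β) {μ : Measure ChainConfig}
    (hss : (pinnedChain ω₂ lam β γ).HasSuperstabilityEstimate μ)
    (D : InfiniteChainDynamics (pinnedChain ω₂ lam β γ)) (hD : D.PreservesMeasure μ) (t : ℝ)
    (x : ℤ) :
    Integrable (fun σ => (pinnedChain ω₂ lam β γ).bondCurrentZ σ 0 *
      (pinnedChain ω₂ lam β γ).bondCurrentZ (D.flow t σ) x) μ :=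
  D.integrable_bondCurrentZ_mul_bondCurrentZ_flow hss one_le_two (pinnedChain_U_nonneg β γ hω hl)
    (measurable_pinnedChain_U ω₂ lam β γ) (pinnedChain_isEvenPolyOfDegree_V ω₂ lam γ hβ) hD t x 0

/-- **Uniform bound on the correlation terms for the pinned anharmonic chain**: `|∫ j_0 (j_x ∘ φ_t) dμ| ≤ B`
for all `t`, `x` (the terms of `D.currentCorrelation μ t`; their decay in `x` is a separate matter). [folklore] -/
theorem exists_abs_correlationTerm_le_pinnedChain {ω₂ lam β : ℝ} (γ : ℝ) (hω : 0 ≤ ω₂)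
    (hl : 0 ≤ lam) (hβ : 0 < β) {μ : Measure ChainConfig}
    (hss : (pinnedChain ω₂ lam β γ).HasSuperstabilityEstimate μ)
    (D : InfiniteChainDynamics (pinnedChain ω₂ lam β γ)) (hD : D.PreservesMeasure μ) :
    ∃ B : ℝ, 0 ≤ B ∧ ∀ (t : ℝ) (x : ℤ),
      |∫ σ, (pinnedChain ω₂ lam β γ).bondCurrentZ σ 0 *
          (pinnedChain ω₂ lam β γ).bondCurrentZ (D.flow t σ) x ∂μ| ≤ B := by
  obtain ⟨B, hB, h⟩ := D.exists_abs_integral_bondCurrentZ_mul_bondCurrentZ_flow_le hss one_le_two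
    (pinnedChain_U_nonneg β γ hω hl) (measurable_pinnedChain_U ω₂ lam β γ)
    (pinnedChain_isEvenPolyOfDegree_V ω₂ lam γ hβ) hD
  exact ⟨B, hB, fun t x => h t x 0⟩

/-- **Finite moments of the bond current for the pinned anharmonic chain**: `j_x ∈ L^p(μ)` for every
`p < ∞` and every superstable state `μ`. [folklore] -/
theorem memLp_bondCurrentZ_pinnedChain {ω₂ lam β : ℝ} (γ : ℝ) (hω : 0 ≤ ω₂) (hl : 0 ≤ lam)
    (hβ : 0 < β) {μ : Measure ChainConfig}
    (hss : (pinnedChain ω₂ lam β γ).HasSuperstabilityEstimate μ) (x : ℤ) {p : ℝ≥0∞}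
    (hp : p ≠ ∞) : MemLp (fun σ => (pinnedChain ω₂ lam β γ).bondCurrentZ σ x) p μ :=
  hss.memLp_bondCurrentZ one_le_two (pinnedChain_U_nonneg β γ hω hl)
    (measurable_pinnedChain_U ω₂ lam β γ) (pinnedChain_isEvenPolyOfDegree_V ω₂ lam γ hβ) x hp

end OscillatorChain

end Literature.MathematicalPhysics.KineticTheory.HeatConduction

end
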